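import Summits.QuantumFields.YangMills.Theorems.BalabanUVNodesN19LawPriceTwoSided
import Literature.MathematicalPhysics.QuantumFieldTheory.Balaban1983to89.T4Crossover

/-!
# YM-DAG node N19 (= NE7 proper) — THE HÖLDER LADDER OF THE LAW PRICE: exactly `(log(e+L)∕(1+L))^α` on the `α`-Hölder class, two-sided

Cell `pub-ymgap`, HUMAN RULING D-0062 (Track A), R141 (C) wider-strategy seat `pub-ymgap-dag-n19-e` (strategy s3 = ALTERNATIVE CURRENCY), generation
g19, module 5 (lineage module 57).  Route `Summits/QuantumFields/YangMills/Theses/BalabanUVNodes.lean` rev 25, cluster item K3⁷ «SpineGivenEndpointR13SepCoPH»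
(stmt-QuantumFields-20544, dag-lead WORDS-143); filed `--supports` that item `--as helper` (it proves no registered stub).  COUNT-NEUTRAL: [folklore] real
analysis over Mathlib (Steklov means via `Continuous.integral_hasStrictDerivAt`, `lipschitzWith_of_nnnorm_deriv_le`, `Real.rpow`; the tree's
`T4Crossover.min_le_rpow_mul_rpow` BY NAME) + the seat's p555512
`…N19LawPriceTwoSided` (`law_price_le_logRate`), p553677 `…N19LawPriceLowerRate` (`exists_cgf_close_laws_far_rate`), p543481 `…N19LawPrice`
(`lipschitzWith_one_cosWave`, `cosWave_nonneg`, `cosWave_le`) and p554543 `…N19LawPriceJackson` (`integrable_of_continuous_Icc_symm`) BY NAME; generic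
probability (two laws on `[−1,1]` with `ε`-close cgf's), no scheme object; NOT a discharge claim.

THE RESULT (v15's open item (m)).  p553677 ∕ p555512: on the LIPSCHITZ class the law-level price of `ε`-close cumulant generating functions on a window
`|t| ≤ l₀` is exactly the rate `ρ(ε) = log(e+L)∕(1+L)`, `L = log⁺ε⁻¹`, two-sided.  On the `α`-HÖLDER class (`|g x − g y| ≤ H|x − y|^α`, `0 < α ≤ 1`) the
price is exactly `ρ(ε)^α`, two-sided:
* ★★ `law_price_le_logRate_rpow` (UPPER): `|∫ g dν − ∫ g dμ| ≤ (2 + 768·c(l₀))·(H + G)·ρ(ε)^α`, `c(l₀) = 6 + l₀ + log max(1, 4e∕l₀)` — the Steklov mean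
  `s_h = h⁻¹∫_x^{x+h} g` of an `α`-Hölder `g` is `H h^{α−1}`-Lipschitz and `H h^α`-close to `g` (§1); p555512's Lipschitz price on `s_h` at `h = ρ(ε)`.
* ★★ `law_price_ge_logRate_rpow` (LOWER): for every `l₀ > 0`, `0 < α ≤ 1`, `ε₀ > 0` there are probability laws on `[0,1]` with cgf's `ε`-close on
  `|t| ≤ l₀`, `0 < ε ≤ min ε₀ 1`, and an `α`-Hölder test function with constant `1` and values in `[0,1]` paid at least `(ρ(ε)∕12)^α` — p553677's binomial
  witness with the RESCALED cosine wave `(2∕(πn))^{α−1}·(1 − cos(πnx))∕(πn)` (`α`-Hölder-1 because `min(t, s) ≤ t^α s^{1−α}`; paid `(2∕(πn))^α`).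
* ★★ `law_price_holder_two_sided` — both in one display.

HONEST FRAMING (binding).  [folklore]; NO consumer in the DAG today (it completes the seat's law-level price on the Hölder scale; constants not optimised);
nothing of Bałaban's instantiated; NE7 NOT PRINTED, NOT proved; N19 NOT discharged; count-neutral.  One finite `T⁴` programme at fixed `ε`; nothing continuum ∕
`ℝ⁴` ∕ OS ∕ mass-gap ∕ Clay.  0 `def` ∕ 0 `sorry`.
-/

noncomputable section

open Real Filter Topology MeasureTheory ProbabilityTheory

namespace Summit.QuantumFields.YangMills.Theorems.BalabanUVNodesN19LawPriceHolder

open Summit.QuantumFields.YangMills.Theorems.BalabanUVNodesN19LawPrice (lipschitzWith_one_cosWave cosWave_nonneg cosWave_le)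
open Summit.QuantumFields.YangMills.Theorems.BalabanUVNodesN19LawPriceLowerRate (exists_cgf_close_laws_far_rate)
open Summit.QuantumFields.YangMills.Theorems.BalabanUVNodesN19LawPriceJackson (integrable_of_continuous_Icc_symm)
open Summit.QuantumFields.YangMills.Theorems.BalabanUVNodesN19LawPriceTwoSided (law_price_le_logRate)
open Literature.MathematicalPhysics.QuantumFieldTheory.Balaban1983to89.T4Crossover (min_le_rpow_mul_rpow)

/-! ## §1 Hölder functions: continuity, and the Steklov mean (`H h^{α−1}`-Lipschitz, `H h^α`-close) [folklore] -/

/-- An `α`-Hölder function (`0 < α`) is continuous. [folklore] -/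
theorem continuous_of_holder {g : ℝ → ℝ} {H α : ℝ} (hα0 : 0 < α) (hg : ∀ x y, |g x - g y| ≤ H * |x - y| ^ α) : Continuous g := by
  refine continuous_iff_continuousAt.2 fun x => ?_
  rw [ContinuousAt, tendsto_iff_norm_sub_tendsto_zero]
  have h0 : Tendsto (fun y : ℝ => H * |y - x| ^ α) (𝓝 x) (𝓝 0) := by
    have hc : Continuous fun y : ℝ => H * |y - x| ^ α :=
      continuous_const.mul ((continuous_id.sub continuous_const).abs.rpow_const fun _ => Or.inr hα0.le)
    simpa [Real.zero_rpow hα0.ne'] using hc.tendsto x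
  exact squeeze_zero (fun y => norm_nonneg _) (fun y => by rw [Real.norm_eq_abs]; exact hg y x) h0

/-- **THE STEKLOV MEAN OF A HÖLDER FUNCTION** [folklore]: for `|g x − g y| ≤ H|x − y|^α` (`0 ≤ H`, `0 < α ≤ 1`) and `h > 0`, the mean
`s(x) = h⁻¹∫_x^{x+h} g` has derivative `(g(x+h) − g(x))∕h`, `|s′| ≤ H h^{α−1}`, and `|g − s| ≤ H h^α`. -/
theorem steklov_holder {g : ℝ → ℝ} {H α : ℝ} (hH : 0 ≤ H) (hα0 : 0 < α) (hg : ∀ x y, |g x - g y| ≤ H * |x - y| ^ α)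
    {h : ℝ} (hh : 0 < h) (x : ℝ) :
    HasDerivAt (fun x => ((∫ y in (0 : ℝ)..(x + h), g y) - ∫ y in (0 : ℝ)..x, g y) / h) ((g (x + h) - g x) / h) x ∧
      |(g (x + h) - g x) / h| ≤ H * h ^ (α - 1) ∧
      |g x - ((∫ y in (0 : ℝ)..(x + h), g y) - ∫ y in (0 : ℝ)..x, g y) / h| ≤ H * h ^ α := by
  have hgc : Continuous g := continuous_of_holder hα0 hg
  have hG : ∀ z : ℝ, HasDerivAt (fun u => ∫ y in (0 : ℝ)..u, g y) (g z) z := fun z =>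
    (hgc.integral_hasStrictDerivAt 0 z).hasDerivAt
  refine ⟨?_, ?_, ?_⟩
  · have h1 : HasDerivAt (fun u => ∫ y in (0 : ℝ)..(u + h), g y) (g (x + h)) x :=
      HasDerivAt.comp_add_const x h (hG (x + h))
    exact (h1.sub (hG x)).div_const h
  · rw [abs_div, abs_of_pos hh, div_le_iff₀ hh, mul_assoc, ← Real.rpow_add_one hh.ne', sub_add_cancel]
    have h1 := hg (x + h) x
    rwa [add_sub_cancel_left, abs_of_pos hh] at h1
  · have hint : ∀ a b : ℝ, IntervalIntegrable g volume a b := fun a b => hgc.intervalIntegrable a b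
    rw [intervalIntegral.integral_interval_sub_left (hint 0 (x + h)) (hint 0 x)]
    have hconst : ∫ _ in x..(x + h), g x = h * g x := by
      rw [intervalIntegral.integral_const, add_sub_cancel_left, smul_eq_mul]
    have hsub : (∫ y in x..(x + h), g y) - h * g x = ∫ y in x..(x + h), (g y - g x) := by
      rw [intervalIntegral.integral_sub (hint x (x + h)) intervalIntegrable_const, hconst]
    have hbound : |∫ y in x..(x + h), (g y - g x)| ≤ H * h ^ α * |x + h - x| := by
      have h1 := intervalIntegral.norm_integral_le_of_norm_le_const (a := x) (b := x + h) (C := H * h ^ α)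
        (f := fun y => g y - g x) fun y hy => ?_
      · simpa only [Real.norm_eq_abs] using h1
      · rw [Set.uIoc_of_le (by linarith), Set.mem_Ioc] at hy
        rw [Real.norm_eq_abs]
        refine (hg y x).trans (mul_le_mul_of_nonneg_left ?_ hH)
        rw [abs_of_pos (by linarith : 0 < y - x)]
        exact Real.rpow_le_rpow (by linarith) (by linarith) hα0.le
    rw [add_sub_cancel_left, abs_of_pos hh] at hbound
    calc |g x - (∫ y in x..(x + h), g y) / h| = |∫ y in x..(x + h), (g y - g x)| / h := by
          rw [← hsub, ← abs_of_pos hh, ← abs_div, abs_of_pos hh, sub_div, mul_div_cancel_left₀ _ hh.ne', abs_sub_comm]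
      _ ≤ H * h ^ α * h / h := div_le_div_of_nonneg_right hbound hh.le
      _ = H * h ^ α := mul_div_cancel_right₀ _ hh.ne'

/-- The Steklov mean of an `α`-Hölder function is `H h^{α−1}`-Lipschitz and continuous. [folklore] -/
theorem lipschitzWith_steklov_holder {g : ℝ → ℝ} {H α : ℝ} (hH : 0 ≤ H) (hα0 : 0 < α) (hg : ∀ x y, |g x - g y| ≤ H * |x - y| ^ α)
    {h : ℝ} (hh : 0 < h) :
    LipschitzWith (Real.toNNReal (H * h ^ (α - 1))) (fun x => ((∫ y in (0 : ℝ)..(x + h), g y) - ∫ y in (0 : ℝ)..x, g y) / h) := by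
  refine lipschitzWith_of_nnnorm_deriv_le (fun x => (steklov_holder hH hα0 hg hh x).1.differentiableAt) fun x => ?_
  rw [(steklov_holder hH hα0 hg hh x).1.deriv, ← NNReal.coe_le_coe, coe_nnnorm, Real.norm_eq_abs,
    Real.coe_toNNReal _ (mul_nonneg hH (Real.rpow_nonneg hh.le _))]
  exact (steklov_holder hH hα0 hg hh x).2.1

/-! ## §2 UPPER: the Lipschitz price of the Steklov mean at `h = ρ(ε)` [folklore] -/

/-- The rate `ρ = log(e+L)∕(1+L)` lies in `(0, 1]` for `L ≥ 0`. [bookkeeping] -/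
theorem logRate_pos_le_one {L : ℝ} (hL : 0 ≤ L) :
    0 < Real.log (Real.exp 1 + L) / (1 + L) ∧ Real.log (Real.exp 1 + L) / (1 + L) ≤ 1 := by
  have he : 1 < Real.exp 1 + L := by linarith [Real.add_one_le_exp (1 : ℝ)]
  refine ⟨div_pos (Real.log_pos he) (by linarith), (div_le_one (by linarith)).2 ?_⟩
  rw [Real.log_le_iff_le_exp (by linarith)]
  calc Real.exp 1 + L ≤ Real.exp 1 * (L + 1) := by nlinarith [Real.add_one_le_exp (1 : ℝ)]
    _ ≤ Real.exp 1 * Real.exp L := mul_le_mul_of_nonneg_left (Real.add_one_le_exp L) (Real.exp_pos 1).le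
    _ = Real.exp (1 + L) := by rw [Real.exp_add]

variable {μ ν : Measure ℝ} [IsProbabilityMeasure μ] [IsProbabilityMeasure ν]

/-- **★★ THE LAW PRICE ON THE HÖLDER CLASS — UPPER** [folklore]: probability laws `μ`, `ν` on `[−1,1]` whose cgf's are `ε`-close on `|t| ≤ l₀`
(`0 < ε ≤ 1`, `0 < l₀`); `g` with `|g x − g y| ≤ H|x − y|^α` (`0 ≤ H`, `0 < α ≤ 1`) and `|g| ≤ G` on `[−1,1]`.  Then
`|∫ g dν − ∫ g dμ| ≤ (2 + 768·c(l₀))·(H + G)·ρ(ε)^α`, `ρ(ε) = log(e+L)∕(1+L)`, `L = log⁺ε⁻¹`, `c(l₀) = 6 + l₀ + log max(1, 4e∕l₀)`: the Steklov mean `s` at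
`h = ρ(ε)` is `Hh^{α−1}`-Lipschitz with `|s| ≤ G + H` on `[−1,1]` and `|g − s| ≤ Hh^α`; p555512 `law_price_le_logRate` prices `s` at
`384c·(Hh^{α−1} + G + H)·h`; and `h ≤ h^α`. -/
theorem law_price_le_logRate_rpow (hμ : μ (Set.Icc (-1) 1)ᶜ = 0) (hν : ν (Set.Icc (-1) 1)ᶜ = 0) {ε l₀ : ℝ} (hl₀ : 0 < l₀)
    (hε : 0 < ε) (hε1 : ε ≤ 1) (hclose : ∀ t : ℝ, |t| ≤ l₀ → |cgf id ν t - cgf id μ t| ≤ ε)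
    {g : ℝ → ℝ} {H α : ℝ} (hH : 0 ≤ H) (hα0 : 0 < α) (hα1 : α ≤ 1) (hg : ∀ x y, |g x - g y| ≤ H * |x - y| ^ α)
    {G : ℝ} (hG : ∀ x ∈ Set.Icc (-1 : ℝ) 1, |g x| ≤ G) :
    |∫ x, g x ∂ν - ∫ x, g x ∂μ| ≤
      (2 + 768 * (6 + l₀ + Real.log (max 1 (4 * Real.exp 1 / l₀)))) * (H + G) *
        (Real.log (Real.exp 1 + Real.posLog ε⁻¹) / (1 + Real.posLog ε⁻¹)) ^ α := by
  set ρ : ℝ := Real.log (Real.exp 1 + Real.posLog ε⁻¹) / (1 + Real.posLog ε⁻¹) with hρ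
  obtain ⟨hρ0, hρ1⟩ := logRate_pos_le_one (L := Real.posLog ε⁻¹) Real.posLog_nonneg
  set c : ℝ := 6 + l₀ + Real.log (max 1 (4 * Real.exp 1 / l₀)) with hc
  have hc0 : 0 ≤ c := by
    have : 0 ≤ Real.log (max 1 (4 * Real.exp 1 / l₀)) := Real.log_nonneg (le_max_left _ _)
    simp only [hc]; linarith
  have hG0 : 0 ≤ G := (abs_nonneg _).trans (hG 0 (by norm_num))
  -- the Steklov mean at `h = ρ`
  set s : ℝ → ℝ := fun x => ((∫ y in (0 : ℝ)..(x + ρ), g y) - ∫ y in (0 : ℝ)..x, g y) / ρ with hs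
  have hsL : LipschitzWith (Real.toNNReal (H * ρ ^ (α - 1))) s := lipschitzWith_steklov_holder hH hα0 hg hρ0
  have hclose_gs : ∀ x, |g x - s x| ≤ H * ρ ^ α := fun x => (steklov_holder hH hα0 hg hρ0 x).2.2
  have hρα1 : ρ ^ α ≤ 1 := Real.rpow_le_one hρ0.le hρ1 hα0.le
  have hρα : ρ ≤ ρ ^ α := by
    have h := Real.rpow_le_rpow_of_exponent_ge hρ0 hρ1 hα1
    rwa [Real.rpow_one] at h
  have hsG : ∀ x ∈ Set.Icc (-1 : ℝ) 1, |s x| ≤ G + H := fun x hx => by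
    have h1 := hclose_gs x
    have h2 := hG x hx
    have h3 : |s x| ≤ |g x| + |g x - s x| := by
      have := abs_sub_abs_le_abs_sub (s x) (g x); rw [abs_sub_comm] at this; linarith
    have h4 : H * ρ ^ α ≤ H := by nlinarith
    linarith
  -- the Lipschitz price of `s`
  have hprice := law_price_le_logRate hμ hν hl₀ hε hε1 hclose hsL hsG
  rw [Real.coe_toNNReal _ (mul_nonneg hH (Real.rpow_nonneg hρ0.le _))] at hprice
  -- the two smoothing errors
  have hgc : Continuous g := continuous_of_holder hα0 hg
  have hsc : Continuous s := hsL.continuous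
  have herr : ∀ (κ : Measure ℝ) [IsProbabilityMeasure κ], κ (Set.Icc (-1) 1)ᶜ = 0 → |∫ x, g x ∂κ - ∫ x, s x ∂κ| ≤ H * ρ ^ α := by
    intro κ _ hκ
    rw [← integral_sub (integrable_of_continuous_Icc_symm hκ hgc) (integrable_of_continuous_Icc_symm hκ hsc), ← Real.norm_eq_abs]
    refine (norm_integral_le_of_norm_le_const (Filter.Eventually.of_forall fun x => ?_)).trans (by rw [probReal_univ, mul_one])
    rw [Real.norm_eq_abs]
    exact hclose_gs x
  have hν' := herr ν hν
  have hμ' := herr μ hμ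
  -- `H ρ^{α−1} · ρ = H ρ^α`
  have hpow : H * ρ ^ (α - 1) * ρ = H * ρ ^ α := by
    rw [mul_assoc, ← Real.rpow_add_one hρ0.ne', sub_add_cancel]
  have key : |∫ x, g x ∂ν - ∫ x, g x ∂μ| ≤ 2 * (H * ρ ^ α) + 384 * c * (H * ρ ^ (α - 1) + (G + H)) * ρ := by
    have hsplit : ∫ x, g x ∂ν - ∫ x, g x ∂μ =
        (∫ x, g x ∂ν - ∫ x, s x ∂ν) + (∫ x, s x ∂ν - ∫ x, s x ∂μ) - (∫ x, g x ∂μ - ∫ x, s x ∂μ) := by ring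
    rw [hsplit]
    refine (abs_sub _ _).trans ((add_le_add (abs_add_le _ _) le_rfl).trans ?_)
    linarith
  refine key.trans ?_
  have h1 : 384 * c * (H * ρ ^ (α - 1) + (G + H)) * ρ = 384 * c * (H * ρ ^ α) + 384 * c * (G + H) * ρ := by
    rw [← hpow]; ring
  rw [h1]
  have h2 : 384 * c * (G + H) * ρ ≤ 384 * c * (G + H) * ρ ^ α :=
    mul_le_mul_of_nonneg_left hρα (by positivity)
  nlinarith [mul_nonneg hc0 (mul_nonneg hG0 (Real.rpow_nonneg hρ0.le α)), mul_nonneg hH (Real.rpow_nonneg hρ0.le α),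
    mul_nonneg hG0 (Real.rpow_nonneg hρ0.le α)]

/-! ## §3 LOWER: the rescaled cosine wave at the binomial witness [folklore] -/

omit [IsProbabilityMeasure μ] [IsProbabilityMeasure ν] in
/-- **THE RESCALED COSINE WAVE IS `α`-HÖLDER WITH CONSTANT ONE** [folklore]: `φ(x) = (2∕(πn))^{α−1}·(1 − cos(πnx))∕(πn)` satisfies
`|φ x − φ y| ≤ |x − y|^α` (the wave is `1`-Lipschitz with values in `[0, 2∕(πn)]`, so `|Δ| ≤ min(|x−y|, 2∕(πn)) ≤ |x−y|^α (2∕(πn))^{1−α}` —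
the tree's `T4Crossover.min_le_rpow_mul_rpow`) and
`0 ≤ φ ≤ (2∕(πn))^α ≤ 1`. -/
theorem rescaledCosWave_holder {n : ℕ} (hn : 0 < n) {α : ℝ} (hα0 : 0 < α) (hα1 : α ≤ 1) :
    (∀ x y : ℝ, |(2 / (π * n)) ^ (α - 1) * ((1 - cos (π * n * x)) / (π * n)) - (2 / (π * n)) ^ (α - 1) * ((1 - cos (π * n * y)) / (π * n))|
        ≤ |x - y| ^ α) ∧
      ∀ x : ℝ, 0 ≤ (2 / (π * n)) ^ (α - 1) * ((1 - cos (π * n * x)) / (π * n)) ∧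
        (2 / (π * n)) ^ (α - 1) * ((1 - cos (π * n * x)) / (π * n)) ≤ (2 / (π * n)) ^ α ∧ (2 / (π * n)) ^ α ≤ 1 := by
  have hs : 0 < 2 / (π * n) := by positivity
  have hs1 : 2 / (π * n) ≤ 1 := by
    rw [div_le_one (by positivity)]
    have h1 : (1 : ℝ) ≤ n := by exact_mod_cast hn
    nlinarith [Real.pi_gt_three]
  have hc0 : 0 < (2 / (π * n)) ^ (α - 1) := Real.rpow_pos_of_pos hs _
  refine ⟨fun x y => ?_, fun x => ⟨mul_nonneg hc0.le (cosWave_nonneg n x), ?_, Real.rpow_le_one hs.le hs1 hα0.le⟩⟩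
  · rw [← mul_sub, abs_mul, abs_of_pos hc0]
    have hL := (lipschitzWith_one_cosWave hn).dist_le_mul x y
    rw [NNReal.coe_one, one_mul, Real.dist_eq, Real.dist_eq] at hL
    have hB : |(1 - cos (π * n * x)) / (π * n) - (1 - cos (π * n * y)) / (π * n)| ≤ 2 / (π * n) := by
      rw [abs_sub_le_iff]
      constructor <;> linarith [cosWave_nonneg n x, cosWave_le n x, cosWave_nonneg n y, cosWave_le n y]
    calc (2 / (π * n)) ^ (α - 1) * |(1 - cos (π * n * x)) / (π * n) - (1 - cos (π * n * y)) / (π * n)|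
        ≤ (2 / (π * n)) ^ (α - 1) * min |x - y| (2 / (π * n)) := mul_le_mul_of_nonneg_left (le_min hL hB) hc0.le
      _ ≤ (2 / (π * n)) ^ (α - 1) * (|x - y| ^ α * (2 / (π * n)) ^ (1 - α)) :=
          mul_le_mul_of_nonneg_left (min_le_rpow_mul_rpow (abs_nonneg _) hs.le hα0.le hα1) hc0.le
      _ = |x - y| ^ α := by
          rw [mul_comm, mul_assoc, ← Real.rpow_add hs, show (1 - α + (α - 1) : ℝ) = 0 by ring, Real.rpow_zero, mul_one]
  · calc (2 / (π * n)) ^ (α - 1) * ((1 - cos (π * n * x)) / (π * n)) ≤ (2 / (π * n)) ^ (α - 1) * (2 / (π * n)) :=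
          mul_le_mul_of_nonneg_left (cosWave_le n x) hc0.le
      _ = (2 / (π * n)) ^ α := by rw [← Real.rpow_add_one hs.ne', sub_add_cancel]

omit [IsProbabilityMeasure μ] [IsProbabilityMeasure ν] in
/-- **★★ THE LAW PRICE ON THE HÖLDER CLASS — LOWER** [folklore]: for every window `l₀ > 0`, exponent `0 < α ≤ 1` and `ε₀ > 0` there are probability laws
on `[0,1]` whose cgf's are `ε`-close on `|t| ≤ l₀` with `0 < ε ≤ min ε₀ 1`, and an `α`-Hölder test function with constant `1` and values in `[0,1]`, paid at
least `(ρ(ε)∕12)^α` (p553677's binomial witness at a large level `n`; the rescaled cosine wave is paid `(2∕(πn))^α ≥ (ρ(ε)∕12)^α`). -/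
theorem law_price_ge_logRate_rpow {l₀ : ℝ} (hl₀ : 0 < l₀) {α : ℝ} (hα0 : 0 < α) (hα1 : α ≤ 1) {ε₀ : ℝ} (hε₀ : 0 < ε₀) :
    ∃ μ ν : Measure ℝ, IsProbabilityMeasure μ ∧ IsProbabilityMeasure ν ∧ μ (Set.Icc 0 1)ᶜ = 0 ∧ ν (Set.Icc 0 1)ᶜ = 0 ∧
      ∃ ε : ℝ, 0 < ε ∧ ε ≤ min ε₀ 1 ∧ (∀ t : ℝ, |t| ≤ l₀ → |cgf id ν t - cgf id μ t| ≤ ε) ∧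
        ∃ φ : ℝ → ℝ, (∀ x y, |φ x - φ y| ≤ |x - y| ^ α) ∧ (∀ x, 0 ≤ φ x ∧ φ x ≤ 1) ∧
          (Real.log (Real.exp 1 + Real.posLog ε⁻¹) / (12 * (1 + Real.posLog ε⁻¹))) ^ α ≤ |∫ x, φ x ∂ν - ∫ x, φ x ∂μ| := by
  -- a level `n` meeting p553677's side conditions and `1∕n ≤ ε₀`
  obtain ⟨n, hn⟩ := exists_nat_ge (max (max (max 2 ((l₀ * Real.exp l₀) ^ 2)) (max (2 * Real.exp l₀) (4 / l₀))) (max (l₀ / 2) ε₀⁻¹))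
  have hn2r : (2 : ℝ) ≤ n := le_trans (by simp) hn
  have hn2 : 2 ≤ n := by exact_mod_cast hn2r
  have hn0 : 0 < n := by omega
  have hnr : (0 : ℝ) < n := by exact_mod_cast hn0
  have hna : (l₀ * Real.exp l₀) ^ 2 ≤ n := le_trans (by simp) hn
  have hne : 2 * Real.exp l₀ ≤ n := le_trans (by simp) hn
  have hnl : 4 / l₀ ≤ n := le_trans (by simp) hn
  have hln : l₀ ≤ 2 * n := by have : l₀ / 2 ≤ n := le_trans (by simp) hn; linarith
  have hnε : ε₀⁻¹ ≤ n := le_trans (by simp) hn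
  obtain ⟨μ, ν, iμ, iν, hμ, hν, ε, hε, -, hεn, hclose, -, -, hpay, hrate⟩ := exists_cgf_close_laws_far_rate hl₀ hn2 hna hne hnl hln
  have hε1 : ε ≤ 1 := hεn.trans (by rw [div_le_one hnr]; linarith)
  have hεε₀ : ε ≤ ε₀ := hεn.trans (by rw [one_div]; exact inv_le_of_inv_le₀ hε₀ hnε)
  obtain ⟨hφ, hφb⟩ := rescaledCosWave_holder hn0 hα0 hα1
  refine ⟨μ, ν, iμ, iν, hμ, hν, ε, hε, le_min hεε₀ hε1, hclose, _, hφ, fun x => ⟨(hφb x).1, (hφb x).2.1.trans (hφb x).2.2⟩, ?_⟩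
  -- payment `(2∕(πn))^α`
  have hs : 0 < 2 / (π * n) := by positivity
  have hc0 : 0 < (2 / (π * n)) ^ (α - 1) := Real.rpow_pos_of_pos hs _
  have hint : ∀ (κ : Measure ℝ), ∫ x, (2 / (π * n)) ^ (α - 1) * ((1 - cos (π * n * x)) / (π * n)) ∂κ =
      (2 / (π * n)) ^ (α - 1) * ∫ x, (1 - cos (π * n * x)) / (π * n) ∂κ := fun κ => integral_const_mul _ _
  rw [hint, hint, ← mul_sub, abs_mul, abs_of_pos hc0, hpay, ← Real.rpow_add_one hs.ne', sub_add_cancel]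
  have hr0 : 0 ≤ Real.log (Real.exp 1 + Real.posLog ε⁻¹) / (12 * (1 + Real.posLog ε⁻¹)) :=
    div_nonneg (Real.log_nonneg (by linarith [Real.add_one_le_exp (1 : ℝ), Real.posLog_nonneg (x := ε⁻¹)]))
      (mul_nonneg (by norm_num) (add_nonneg zero_le_one Real.posLog_nonneg))
  exact Real.rpow_le_rpow hr0 (hrate.trans (le_of_eq hpay)) hα0.le

/-! ## §4 Two-sided -/

omit [IsProbabilityMeasure μ] [IsProbabilityMeasure ν] in
/-- **★★ THE HÖLDER LADDER, TWO-SIDED** [folklore]: on the `α`-Hölder class (`0 < α ≤ 1`) the law-level price of `ε`-close cumulant generating functions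
on a window `|t| ≤ l₀` is EXACTLY `ρ(ε)^α = (log(e+L)∕(1+L))^α`, `L = log⁺ε⁻¹`, up to constants depending on `l₀` only: (upper) for all laws on `[−1,1]`,
`0 < ε ≤ 1`, all `g` with `|g x − g y| ≤ H|x−y|^α`, `|g| ≤ G` on `[−1,1]`: `≤ (2 + 768c(l₀))(H+G)·ρ(ε)^α`; (lower) for every `ε₀ > 0` some pair of laws on
`[−1,1]` with `0 < ε ≤ min ε₀ 1` and an `α`-Hölder-1, `[0,1]`-valued `φ` is paid `≥ (ρ(ε)∕12)^α`.  `α = 1` is p555512's `law_price_two_sided`. -/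
theorem law_price_holder_two_sided {l₀ : ℝ} (hl₀ : 0 < l₀) {α : ℝ} (hα0 : 0 < α) (hα1 : α ≤ 1) :
    (∀ (μ ν : Measure ℝ) [IsProbabilityMeasure μ] [IsProbabilityMeasure ν],
      μ (Set.Icc (-1) 1)ᶜ = 0 → ν (Set.Icc (-1) 1)ᶜ = 0 → ∀ ε : ℝ, 0 < ε → ε ≤ 1 →
        (∀ t : ℝ, |t| ≤ l₀ → |cgf id ν t - cgf id μ t| ≤ ε) →
        ∀ (g : ℝ → ℝ) (H G : ℝ), 0 ≤ H → (∀ x y, |g x - g y| ≤ H * |x - y| ^ α) → (∀ x ∈ Set.Icc (-1 : ℝ) 1, |g x| ≤ G) →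
          |∫ x, g x ∂ν - ∫ x, g x ∂μ| ≤
            (2 + 768 * (6 + l₀ + Real.log (max 1 (4 * Real.exp 1 / l₀)))) * (H + G) *
              (Real.log (Real.exp 1 + Real.posLog ε⁻¹) / (1 + Real.posLog ε⁻¹)) ^ α) ∧
    (∀ ε₀ : ℝ, 0 < ε₀ → ∃ μ ν : Measure ℝ, IsProbabilityMeasure μ ∧ IsProbabilityMeasure ν ∧
      μ (Set.Icc (-1) 1)ᶜ = 0 ∧ ν (Set.Icc (-1) 1)ᶜ = 0 ∧
      ∃ ε : ℝ, 0 < ε ∧ ε ≤ min ε₀ 1 ∧ (∀ t : ℝ, |t| ≤ l₀ → |cgf id ν t - cgf id μ t| ≤ ε) ∧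
        ∃ φ : ℝ → ℝ, (∀ x y, |φ x - φ y| ≤ |x - y| ^ α) ∧ (∀ x, 0 ≤ φ x ∧ φ x ≤ 1) ∧
          (Real.log (Real.exp 1 + Real.posLog ε⁻¹) / (12 * (1 + Real.posLog ε⁻¹))) ^ α ≤ |∫ x, φ x ∂ν - ∫ x, φ x ∂μ|) := by
  refine ⟨fun μ ν _ _ hμ hν ε hε hε1 hclose g H G hH hg hG => law_price_le_logRate_rpow hμ hν hl₀ hε hε1 hclose hH hα0 hα1 hg hG,
    fun ε₀ hε₀ => ?_⟩
  obtain ⟨μ, ν, iμ, iν, hμ, hν, ε, hε, hεm, hclose, φ, hφ, hφb, hpay⟩ := law_price_ge_logRate_rpow hl₀ hα0 hα1 hε₀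
  have hsub : (Set.Icc (-1 : ℝ) 1)ᶜ ⊆ (Set.Icc (0 : ℝ) 1)ᶜ := Set.compl_subset_compl.2 (Set.Icc_subset_Icc (by norm_num) le_rfl)
  exact ⟨μ, ν, iμ, iν, measure_mono_null hsub hμ, measure_mono_null hsub hν, ε, hε, hεm, hclose, φ, hφ, hφb, hpay⟩

end Summit.QuantumFields.YangMills.Theorems.BalabanUVNodesN19LawPriceHolder

end
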